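import Mathlib
import HarnessLib
import Literature.MathematicalPhysics.QuantumLattice.DWaveSource
import Literature.MathematicalPhysics.QuantumLattice.DWaveOrderParameterProofs
import Literature.MathematicalPhysics.QuantumLattice.HubbardGrandCanonicalDensity
import Summits.HubbardSuperconductivity.HubbardSuperconductivity.Theorems.WeakCouplingBCSWcbcsBcsConstructionRegularEquationOfState
import Summits.HubbardSuperconductivity.HubbardSuperconductivity.Theorems.WeakCouplingBCSWcbcsBcsConstructionAeDensityConvergence
import Summits.HubbardSuperconductivity.HubbardSuperconductivity.Theorems.WeakCouplingBCSWcbcsBcsConstructionGcDensitySandwichFree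
import Summits.HubbardSuperconductivity.HubbardSuperconductivity.Theorems.ChiralWindowCwChiralConstructionKLWindowOfPoint
import Summits.HubbardSuperconductivity.HubbardSuperconductivity.Theorems.ChiralWindowCwChiralConstructionOfKLMechanism
import Summits.HubbardSuperconductivity.HubbardSuperconductivity.Theorems.ChiralWindowCwChiralConstructionFillingAtNegThreeTenths
import Summits.HubbardSuperconductivity.HubbardSuperconductivity.Theorems.ChiralWindowCwChannelInfContinuousFilling

/-!
# STRATEGY CENSUS companion (gen 1, seat s1) — crux `WcbcsBcsConstruction` (stmt-HubbardSuperconductivity-2010)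

Kernel-checked content of `STRATEGY-CENSUS.md` (gen 1, strategist planner-cstrat-stmt-HubbardSuperconductivity-2010-s1-0):

* §1 **Costume test (T-top)** — splitting the order clause at ANY source stair `h₂(U) > 0` into a TOP-STAIR floor
  `e^{-A/U} ≤ F(U,μ,h₂(U))` (the shape a sourced-BGM theorem would deliver at `h₂ = e^{-a/U}`) and a RATE retention
  `e^{-C'/U²}·F(U,μ,h₂(U)) ≤ F(U,μ,h)` for `h < h₂(U)` is a costume: the retention leaf alone is EQUIVALENT to the floor
  (`MOn_of_TopOn_of_RateOn`, `RateOn_of_MOn`), because `m = ⨅_{h>0} F(h)` and `F ≤ B_d` a priori. (Complements the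
  kernel-checked (T-h) `BottomStairCostume.lean`, (T-L) `SeedCoreIffCrux.lean` and the paper (T-g).)
* §2 **The weakest sufficient equation-of-state leaf (D_val)** of the TYPED crux — "every level window inside
  `[-2,-3/10]` carries ONE `U`-uniformly attainable grand-canonical density" — with `crux_of_Kpt_of_M_of_Dval` (ten lines,
  no EOS machinery) and `Dval_of_D` ((D) no-density-jump ⇒ (D_val), the EOS half of the registered composition).

`F U μ h := liminf_L dWaveSourceDensity (L+1) U μ h` (the stair), `m = dWaveOrderParameter U μ = ⨅_{h>0} F`.
-/

set_option linter.dupNamespace false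

namespace Summit.HubbardSuperconductivity.HubbardSuperconductivity.Cruxes.WcbcsBcsConstruction.StrategyCensusS1

open Literature.MathematicalPhysics.QuantumLattice Literature.Probability.LatticeModels Filter Finset
open scoped Topology

/-- The stair `F(U,μ,h) = liminf_L dWaveSourceDensity (L+1) U μ h`. [cite: KomaTasaki1994, §1] -/
noncomputable def F (U μ h : ℝ) : ℝ := liminf (fun L : ℕ => dWaveSourceDensity (L + 1) U μ h) atTop

/-- The a-priori ceiling `B_d` of every stair. [folklore] -/
noncomputable def Bd : ℝ := 2 * ∑ e ∈ insert (0 : Site 2) unitSteps, |dWaveFormFactor e / Real.sqrt 2|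

theorem F_le_Bd (U μ : ℝ) {h : ℝ} (hh : 0 ≤ h) : F U μ h ≤ Bd := liminf_dWaveSourceDensity_le_const U μ hh

theorem Bd_nonneg : 0 ≤ Bd := by
  unfold Bd
  exact mul_nonneg (by norm_num) (sum_nonneg fun _ _ => abs_nonneg _)

/-! ## §1 The top-stair / rate-retention split is a costume -/

/-- (M on S): the order floor `e^{-C/U²}` on a set `S` of `(U, μ)` pairs (e.g. `μ ∈ [μ₁ + U/2, μ₂]`), for all small `U`. -/
def MOn (S : Set (ℝ × ℝ)) : Prop :=
  ∃ U₀ C : ℝ, 0 < U₀ ∧ 0 < C ∧ ∀ U ∈ Set.Ioo (0:ℝ) U₀, ∀ μ : ℝ, (U, μ) ∈ S →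
    Real.exp (-C / U ^ 2) ≤ dWaveOrderParameter U μ

/-- (Top on S): a floor of shape `e^{-A/U}` on the TOP stair `h₂(U) > 0` — what a sourced weak-coupling expansion with the
pair source as infrared regulator would give at `h₂(U) = e^{-a/U}` (free Cooper-log response times `1 + O(U)`). -/
def TopOn (S : Set (ℝ × ℝ)) (h₂ : ℝ → ℝ) : Prop :=
  ∃ U₀ A : ℝ, 0 < U₀ ∧ 0 < A ∧ ∀ U ∈ Set.Ioo (0:ℝ) U₀, ∀ μ : ℝ, (U, μ) ∈ S →
    0 < h₂ U ∧ Real.exp (-A / U) ≤ F U μ (h₂ U)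

/-- (Rate on S): RATE retention below the top stair — the sourced order keeps a fraction `e^{-C'/U²}` of its value at
`h₂(U)` all the way down. -/
def RateOn (S : Set (ℝ × ℝ)) (h₂ : ℝ → ℝ) : Prop :=
  ∃ U₀ C' : ℝ, 0 < U₀ ∧ 0 < C' ∧ ∀ U ∈ Set.Ioo (0:ℝ) U₀, ∀ μ : ℝ, (U, μ) ∈ S →
    ∀ h ∈ Set.Ioo 0 (h₂ U), Real.exp (-C' / U ^ 2) * F U μ (h₂ U) ≤ F U μ h

/-- `e^{-A/U} ≥ e^{-A/U²}` for `0 < U ≤ 1`, `0 ≤ A`. [folklore] -/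
theorem exp_neg_div_le_exp_neg_div_sq {A U : ℝ} (hA : 0 ≤ A) (hU : 0 < U) (hU1 : U ≤ 1) :
    Real.exp (-A / U ^ 2) ≤ Real.exp (-A / U) := by
  apply Real.exp_le_exp.2
  have hU2 : U ^ 2 ≤ U := by nlinarith
  have h1 : A / U ≤ A / U ^ 2 := div_le_div_of_nonneg_left hA (by positivity) hU2
  rw [neg_div, neg_div]
  exact neg_le_neg h1

/-- **(Top) ∧ (Rate) ⇒ (M)**: floor `e^{-(C'+A)/U²}`. [cite: KomaTasaki1994, §1] -/
theorem MOn_of_TopOn_of_RateOn (S : Set (ℝ × ℝ)) (h₂ : ℝ → ℝ) :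
    TopOn S h₂ → RateOn S h₂ → MOn S := by
  rintro ⟨U₀, A, hU₀, hA, hTop⟩ ⟨U₁, C', hU₁, hC', hRate⟩
  refine ⟨min (min U₀ U₁) 1, C' + A, lt_min (lt_min hU₀ hU₁) one_pos, by linarith, fun U hU μ hS => ?_⟩
  have hUpos : 0 < U := hU.1
  have hUU₀ : U < U₀ := lt_of_lt_of_le hU.2 ((min_le_left _ _).trans (min_le_left _ _))
  have hUU₁ : U < U₁ := lt_of_lt_of_le hU.2 ((min_le_left _ _).trans (min_le_right _ _))
  have hU1 : U ≤ 1 := (lt_of_lt_of_le hU.2 (min_le_right _ _)).le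
  obtain ⟨hh₂, hTopU⟩ := hTop U ⟨hUpos, hUU₀⟩ μ hS
  have hRateU := hRate U ⟨hUpos, hUU₁⟩ μ hS
  -- the combined floor on every stair below and above `h₂ U`
  have hexp : Real.exp (-(C' + A) / U ^ 2) = Real.exp (-C' / U ^ 2) * Real.exp (-A / U ^ 2) := by
    rw [← Real.exp_add]; congr 1; ring
  have hfloor_top : Real.exp (-(C' + A) / U ^ 2) ≤ F U μ (h₂ U) := by
    rw [hexp]
    calc Real.exp (-C' / U ^ 2) * Real.exp (-A / U ^ 2)
        ≤ 1 * Real.exp (-A / U) := by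
          apply mul_le_mul _ (exp_neg_div_le_exp_neg_div_sq hA.le hUpos hU1) (Real.exp_pos _).le zero_le_one
          exact Real.exp_le_one_iff.2 (div_nonpos_of_nonpos_of_nonneg (by linarith) (by positivity))
      _ = Real.exp (-A / U) := one_mul _
      _ ≤ F U μ (h₂ U) := hTopU
  refine le_dWaveOrderParameter_of_forall U μ one_pos fun h hh => ?_
  by_cases hlt : h < h₂ U
  · calc Real.exp (-(C' + A) / U ^ 2)
        = Real.exp (-C' / U ^ 2) * Real.exp (-A / U ^ 2) := hexp
      _ ≤ Real.exp (-C' / U ^ 2) * F U μ (h₂ U) := by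
          apply mul_le_mul_of_nonneg_left _ (Real.exp_pos _).le
          exact (exp_neg_div_le_exp_neg_div_sq hA.le hUpos hU1).trans hTopU
      _ ≤ F U μ h := hRateU h ⟨hh.1, hlt⟩
  · exact hfloor_top.trans (liminf_dWaveSourceDensity_mono U μ hh₂.le (not_lt.mp hlt))

/-- **(M) ⇒ (Rate)** at ANY positive stair function: with `C' := C + 1`, since `F(h) ≥ m ≥ e^{-C/U²}` and
`F(h₂) ≤ B_d ≤ e^{1/U²}` for small `U`. Hence (Rate) carries the whole content of (M): the split (Top)|(Rate) is a
costume at every stair, in particular at the sourced-BGM stair `h₂ = e^{-a/U}`. [cite: KomaTasaki1994, §1] -/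
theorem RateOn_of_MOn (S : Set (ℝ × ℝ)) (h₂ : ℝ → ℝ) (hpos : ∀ U μ : ℝ, (U, μ) ∈ S → 0 < h₂ U) :
    MOn S → RateOn S h₂ := by
  rintro ⟨U₀, C, hU₀, hC, hM⟩
  -- `U₁`: below it, `B_d · e^{-1/U²} ≤ 1`
  set U₁ : ℝ := 1 / Real.sqrt (max Bd 1) with hU₁def
  have hmax : 1 ≤ max Bd 1 := le_max_right _ _
  have hsqrt : 0 < Real.sqrt (max Bd 1) := Real.sqrt_pos.2 (by linarith)
  have hU₁ : 0 < U₁ := by rw [hU₁def]; positivity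
  refine ⟨min U₀ U₁, C + 1, lt_min hU₀ hU₁, by linarith, fun U hU μ hS h hh => ?_⟩
  have hUpos : 0 < U := hU.1
  have hUU₀ : U < U₀ := lt_of_lt_of_le hU.2 (min_le_left _ _)
  have hUU₁ : U < U₁ := lt_of_lt_of_le hU.2 (min_le_right _ _)
  have hm : Real.exp (-C / U ^ 2) ≤ dWaveOrderParameter U μ := hM U ⟨hUpos, hUU₀⟩ μ hS
  have hFh : dWaveOrderParameter U μ ≤ F U μ h := dWaveOrderParameter_le_liminf U μ hh.1
  have hFtop : F U μ (h₂ U) ≤ Bd := F_le_Bd U μ (hpos U μ hS).le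
  -- `B_d ≤ 1/U² ≤ e^{1/U²}`
  have hU2 : U ^ 2 ≤ 1 / max Bd 1 := by
    have hlt : U < 1 / Real.sqrt (max Bd 1) := by rw [hU₁def] at hUU₁; exact hUU₁
    have h1 : U * Real.sqrt (max Bd 1) < 1 := by
      rwa [lt_div_iff₀ hsqrt] at hlt
    have h2 : (U * Real.sqrt (max Bd 1)) ^ 2 ≤ 1 := by
      have h0 : 0 ≤ U * Real.sqrt (max Bd 1) := by positivity
      nlinarith
    rw [mul_pow, Real.sq_sqrt (by linarith)] at h2
    rw [le_div_iff₀ (by linarith)]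
    linarith
  have hBU : Bd * U ^ 2 ≤ 1 := by
    calc Bd * U ^ 2 ≤ max Bd 1 * U ^ 2 := mul_le_mul_of_nonneg_right (le_max_left _ _) (by positivity)
      _ ≤ max Bd 1 * (1 / max Bd 1) := mul_le_mul_of_nonneg_left hU2 (by linarith)
      _ = 1 := by field_simp
  have hexp1 : Bd * Real.exp (-1 / U ^ 2) ≤ 1 := by
    have hx : 0 < 1 / U ^ 2 := by positivity
    have h1 : 1 / U ^ 2 ≤ Real.exp (1 / U ^ 2) := by linarith [Real.add_one_le_exp (1 / U ^ 2)]
    have h2 : Real.exp (-1 / U ^ 2) ≤ U ^ 2 := by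
      rw [show (-1 : ℝ) / U ^ 2 = -(1 / U ^ 2) by ring, Real.exp_neg]
      calc (Real.exp (1 / U ^ 2))⁻¹ ≤ (1 / U ^ 2)⁻¹ := inv_anti₀ hx h1
        _ = U ^ 2 := by rw [one_div, inv_inv]
    calc Bd * Real.exp (-1 / U ^ 2) ≤ Bd * U ^ 2 := mul_le_mul_of_nonneg_left h2 Bd_nonneg
      _ ≤ 1 := hBU
  have hsplit : Real.exp (-(C + 1) / U ^ 2) = Real.exp (-C / U ^ 2) * Real.exp (-1 / U ^ 2) := by
    rw [← Real.exp_add]; congr 1; ring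
  have hF0 : 0 ≤ F U μ (h₂ U) := liminf_dWaveSourceDensity_nonneg U μ (hpos U μ hS).le
  calc Real.exp (-(C + 1) / U ^ 2) * F U μ (h₂ U)
      = Real.exp (-C / U ^ 2) * (Real.exp (-1 / U ^ 2) * F U μ (h₂ U)) := by rw [hsplit]; ring
    _ ≤ Real.exp (-C / U ^ 2) * 1 := by
        apply mul_le_mul_of_nonneg_left _ (Real.exp_pos _).le
        calc Real.exp (-1 / U ^ 2) * F U μ (h₂ U) ≤ Real.exp (-1 / U ^ 2) * Bd :=
              mul_le_mul_of_nonneg_left hFtop (Real.exp_pos _).le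
          _ = Bd * Real.exp (-1 / U ^ 2) := mul_comm _ _
          _ ≤ 1 := hexp1
    _ = Real.exp (-C / U ^ 2) := mul_one _
    _ ≤ F U μ h := hm.trans hFh

/-! ## §2 The weakest sufficient equation-of-state leaf (D_val) of the typed crux -/

/-- (Kpt) — child 1 of the split (byte-identical with the sibling's). -/
def Kpt : Prop :=
  ∃ δ₀ ∈ Set.Icc (3/10 : ℝ) (12/25), ∃ γ U₁ : ℝ, 0 < γ ∧ 0 < U₁ ∧ ∀ U ∈ Set.Ioo (0:ℝ) U₁,
    ∀ χ : D4Irrep, χ ≠ D4Irrep.B1g →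
      channelInf (squareDispersion 1 0) (chemicalPotentialOfDensity (squareDispersion 1 0) (1 - δ₀)) U D4Irrep.B1g
          + γ * U ^ 2 ≤
        channelInf (squareDispersion 1 0) (chemicalPotentialOfDensity (squareDispersion 1 0) (1 - δ₀)) U χ

/-- (M) — child 2 of the split (byte-identical with the registered stub). -/
def M : Prop :=
  ∀ μ₁ μ₂ γ U₁ : ℝ, -2 ≤ μ₁ → μ₁ < μ₂ → μ₂ ≤ -(3:ℝ) / 10 → 0 < γ → 0 < U₁ →
    (∀ U ∈ Set.Ioo (0:ℝ) U₁, ∀ μ ∈ Set.Icc μ₁ μ₂, ∀ χ : D4Irrep, χ ≠ D4Irrep.B1g →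
      channelInf (squareDispersion 1 0) μ U D4Irrep.B1g + γ * U ^ 2 ≤ channelInf (squareDispersion 1 0) μ U χ) →
    ∃ U₀ C : ℝ, 0 < U₀ ∧ 0 < C ∧ ∀ U ∈ Set.Ioo (0:ℝ) U₀, ∀ μ ∈ Set.Icc (μ₁ + U / 2) μ₂,
      Real.exp (-C / U ^ 2) ≤ dWaveOrderParameter U μ

/-- (D) — child 3 of the split (the registered stub `stub_noDensityJumpOnLevelWindows`). -/
def D : Prop :=
  ∀ μ₁ μ₂ : ℝ, -2 ≤ μ₁ → μ₁ < μ₂ → μ₂ ≤ -(3:ℝ) / 10 → ∃ U_J : ℝ, 0 < U_J ∧ ∀ U ∈ Set.Ioo (0:ℝ) U_J,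
    ∀ ν ∈ Set.Icc μ₁ μ₂, ∀ ε > 0, ∃ h > 0, ∃ᶠ L : ℕ in atTop,
      ((hubbardTorusWith 2 (L + 1) 1 U (ν + h)).groundStateFunctional totalNumber).re / ((L + 1 : ℕ) : ℝ) ^ 2 -
        ((hubbardTorusWith 2 (L + 1) 1 U (ν - h)).groundStateFunctional totalNumber).re / ((L + 1 : ℕ) : ℝ) ^ 2 ≤ ε

/-- (D_val) — the WEAKEST equation-of-state statement the typed composition consumes: every level window
`[μ₁, μ₂] ⊂ [-2, -3/10]` carries ONE doping `δ` with `1 - δ` between the free fillings of its ends, attained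
`U`-uniformly — for every small `U` some operator level `μ(U) ∈ [μ₁ + U/2, μ₂]` has grand-canonical tracial ground-state
density `→ 1 - δ` along all side lengths. (D) ⇒ (D_val) (`Dval_of_D`); (D_val) is what a `U`-uniform `δ` literally needs. -/
def Dval : Prop :=
  ∀ μ₁ μ₂ : ℝ, -2 ≤ μ₁ → μ₁ < μ₂ → μ₂ ≤ -(3:ℝ) / 10 → ∃ δ : ℝ,
    1 - δ ∈ Set.Icc (KohnLuttinger.filling (squareDispersion 1 0) μ₁) (KohnLuttinger.filling (squareDispersion 1 0) μ₂) ∧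
    ∃ U_D : ℝ, 0 < U_D ∧ ∀ U ∈ Set.Ioo (0:ℝ) U_D, ∃ μ ∈ Set.Icc (μ₁ + U / 2) μ₂,
      Tendsto (fun L : ℕ => ((hubbardTorusWith 2 (L + 1) 1 U μ).groundStateFunctional totalNumber).re /
        ((L + 1 : ℕ) : ℝ) ^ 2) atTop (𝓝 (1 - δ))

/-- The typed crux, spelled out. -/
def Crux : Prop :=
  ∃ δ ∈ Set.Ioo (0:ℝ) (1 / 2), ∃ U₀ : ℝ, 0 < U₀ ∧ ∃ C : ℝ, 0 < C ∧ ∀ U ∈ Set.Ioo (0:ℝ) U₀, ∃ μ : ℝ,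
    Tendsto (fun L : ℕ => ((hubbardTorusWith 2 (L + 1) 1 U μ).groundStateFunctional totalNumber).re /
      ((L + 1 : ℕ) : ℝ) ^ 2) atTop (𝓝 (1 - δ)) ∧
    Real.exp (-C / U ^ 2) ≤ dWaveOrderParameter U μ

open Summit.HubbardSuperconductivity.HubbardSuperconductivity.Theorems in
/-- The KL level window from (Kpt), inside `[-2, -3/10]`, with its certified end fillings (landed p141740 + fillings). -/
theorem window_of_Kpt (hKpt : Kpt) :
    ∃ μ₁ μ₂ γ U₁ : ℝ, -2 ≤ μ₁ ∧ μ₁ < μ₂ ∧ μ₂ ≤ -(3:ℝ) / 10 ∧ 0 < γ ∧ 0 < U₁ ∧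
      13 / 25 < KohnLuttinger.filling (squareDispersion 1 0) μ₁ ∧
      KohnLuttinger.filling (squareDispersion 1 0) μ₂ < 7 / 10 ∧
      ∀ U ∈ Set.Ioo (0:ℝ) U₁, ∀ μ ∈ Set.Icc μ₁ μ₂, ∀ χ : D4Irrep, χ ≠ D4Irrep.B1g →
        channelInf (squareDispersion 1 0) μ U D4Irrep.B1g + γ * U ^ 2 ≤ channelInf (squareDispersion 1 0) μ U χ := by
  obtain ⟨μ₁, μ₂, γ, U₁, _h4, h12, _h0, hγ, hU₁, hn₁, hn₂, hK⟩ := stub_klLeadingMuWindowOfPoint hKpt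
  have hμ₁ : -2 ≤ μ₁ := by
    by_contra hlt
    have hlt : μ₁ < -2 := not_le.mp hlt
    have := monotone_filling hlt.le
    linarith [filling_neg_two_le_half']
  have hμ₂ : μ₂ ≤ -(3:ℝ) / 10 := by
    by_contra hlt
    have hlt : -(3:ℝ) / 10 < μ₂ := not_le.mp hlt
    have := monotone_filling hlt.le
    linarith [stub_fillingAtNegThreeTenths]
  exact ⟨μ₁, μ₂, γ, U₁, hμ₁, h12, hμ₂, hγ, hU₁, hn₁, hn₂, hK⟩

/-- **(Kpt) ∧ (M) ∧ (D_val) ⇒ typed crux** — a dozen lines, no equation-of-state machinery: (D_val) IS what the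
`U`-uniform `δ` consumes (`δ < 12/25 < 1/2` and `δ > 3/10 > 0` from the certified end fillings). [cite: KomaTasaki1994, §1] -/
theorem crux_of_Kpt_of_M_of_Dval (hKpt : Kpt) (hM : M) (hD : Dval) : Crux := by
  obtain ⟨μ₁, μ₂, γ, U₁, hμ₁, h12, hμ₂, hγ, hU₁, hn₁, hn₂, hK⟩ := window_of_Kpt hKpt
  obtain ⟨U₀, C, hU₀, hC, hMw⟩ := hM μ₁ μ₂ γ U₁ hμ₁ h12 hμ₂ hγ hU₁ hK
  obtain ⟨δ, hδ, U_D, hUD, hDw⟩ := hD μ₁ μ₂ hμ₁ h12 hμ₂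
  refine ⟨δ, ⟨by linarith [hδ.2], by linarith [hδ.1]⟩, min U₀ U_D, lt_min hU₀ hUD, C, hC, fun U hU => ?_⟩
  obtain ⟨μ, hμ, hdens⟩ := hDw U ⟨hU.1, lt_of_lt_of_le hU.2 (min_le_right _ _)⟩
  exact ⟨μ, hdens, hMw U ⟨hU.1, lt_of_lt_of_le hU.2 (min_le_left _ _)⟩ μ hμ⟩

open Summit.HubbardSuperconductivity.HubbardSuperconductivity.Theorems in
/-- **(D) ⇒ (D_val)** — the EOS half of the registered composition (sub-window `[m, μ₂]`, step `r`, free/interacting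
sandwich p148887, differentiability from no-jump, Darboux): (D) is MORE than the typed crux needs.
[cite: KomaTasaki1994, §1] -/
theorem Dval_of_D (hD : D) : Dval := by
  intro μ₁ μ₂ hμ₁ h12 hμ₂
  set m : ℝ := (μ₁ + μ₂) / 2 with hm
  have hm₁ : μ₁ < m := by rw [hm]; linarith
  have hm₂ : m < μ₂ := by rw [hm]; linarith
  obtain ⟨U_J, hUJ, hJ⟩ := hD m μ₂ (by linarith) hm₂ hμ₂
  set r : ℝ := (μ₂ - m) / 6 with hr
  have hrpos : 0 < r := by rw [hr]; linarith
  set Fl : ℝ → ℝ := KohnLuttinger.filling (squareDispersion 1 0) with hF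
  have hI : ∀ x : ℝ, μ₁ ≤ x → x ≤ μ₂ → x ∈ Set.Icc (-4:ℝ) 4 := fun x h1 h2 =>
    ⟨by linarith, by linarith⟩
  have hF1 : Fl (m + r) < Fl (m + 2 * r) :=
    strictMonoOn_filling (hI _ (by linarith) (by linarith)) (hI _ (by linarith) (by linarith)) (by linarith)
  have hF2 : Fl (m + 2 * r) < Fl (μ₂ - 2 * r) :=
    strictMonoOn_filling (hI _ (by linarith) (by linarith)) (hI _ (by linarith) (by linarith)) (by linarith)
  have hF3 : Fl (μ₂ - 2 * r) < Fl (μ₂ - r) :=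
    strictMonoOn_filling (hI _ (by linarith) (by linarith)) (hI _ (by linarith) (by linarith)) (by linarith)
  have hFlo : Fl μ₁ ≤ Fl (μ₂ - 2 * r) := monotone_filling (by linarith)
  have hFhi : Fl (μ₂ - 2 * r) ≤ Fl μ₂ := monotone_filling (by linarith)
  -- the doping bracket `a < b`
  set a : ℝ := 1 - Fl (μ₂ - 2 * r) with ha
  set b : ℝ := 1 - Fl (m + 2 * r) with hb
  have hab : a < b := by rw [ha, hb]; linarith
  set U_B : ℝ := r * min (Fl (m + 2 * r) - Fl (m + r)) (Fl (μ₂ - r) - Fl (μ₂ - 2 * r)) with hUB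
  have hUBpos : 0 < U_B := mul_pos hrpos (lt_min (by linarith) (by linarith))
  refine ⟨a, ⟨by rw [ha]; linarith, by rw [ha]; linarith⟩, min U_J (min U_B (μ₂ - μ₁)),
    lt_min hUJ (lt_min hUBpos (by linarith)), fun U hU => ?_⟩
  have hUpos : 0 < U := hU.1
  have hUUJ : U < U_J := lt_of_lt_of_le hU.2 (min_le_left _ _)
  have hUUB : U < U_B := lt_of_lt_of_le hU.2 ((min_le_right _ _).trans (min_le_left _ _))
  have hUw : U < μ₂ - μ₁ := lt_of_lt_of_le hU.2 ((min_le_right _ _).trans (min_le_right _ _))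
  set e : ℝ → ℝ := fun y : ℝ => limUnder atTop (fun L : ℕ =>
    (hubbardTorusWith 2 (L + 1) 1 U y).groundEnergy / ((L + 1 : ℕ) : ℝ) ^ 2) with he
  have hdiff : ∀ ν ∈ Set.Icc m μ₂, DifferentiableAt ℝ e ν := fun ν hν =>
    wcbcs_eos_differentiableAt_of_noDensityJump U ν (hJ U ⟨hUpos, hUUJ⟩ ν hν)
  have hlim : ∀ μ' : ℝ, Tendsto (fun L : ℕ => (hubbardTorusWith 2 (L + 1) 1 U μ').groundEnergy /
      ((L + 1 : ℕ) : ℝ) ^ 2) atTop (𝓝 (e μ')) := fun μ' => wcbcs_tendsto_gcEnergyDensity_limUnder U μ'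
  have hder : ∀ μ' ∈ Set.Icc m μ₂, HasDerivAt e (deriv e μ') μ' := fun μ' hμ' => (hdiff μ' hμ').hasDerivAt
  have hmI : m ∈ Set.Icc m μ₂ := ⟨le_rfl, hm₂.le⟩
  have hμ₂I : μ₂ ∈ Set.Icc m μ₂ := ⟨hm₂.le, le_rfl⟩
  have hTm := wcbcs_tendsto_gcDensity_of_differentiableAt U m (hdiff m hmI)
  have hTμ₂ := wcbcs_tendsto_gcDensity_of_differentiableAt U μ₂ (hdiff μ₂ hμ₂I)
  obtain ⟨hBm, -⟩ := stub_gcDensitySandwichFree U m r hUpos.le hrpos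
  obtain ⟨-, hBμ₂⟩ := stub_gcDensitySandwichFree U μ₂ r hUpos.le hrpos
  rw [hTm.limsup_eq] at hBm
  rw [hTμ₂.liminf_eq] at hBμ₂
  have hUr1 : U / r ≤ Fl (m + 2 * r) - Fl (m + r) := by
    rw [div_le_iff₀ hrpos]
    calc U ≤ U_B := hUUB.le
      _ ≤ r * (Fl (m + 2 * r) - Fl (m + r)) := by
          rw [hUB]; exact mul_le_mul_of_nonneg_left (min_le_left _ _) hrpos.le
      _ = (Fl (m + 2 * r) - Fl (m + r)) * r := by ring
  have hUr2 : U / r ≤ Fl (μ₂ - r) - Fl (μ₂ - 2 * r) := by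
    rw [div_le_iff₀ hrpos]
    calc U ≤ U_B := hUUB.le
      _ ≤ r * (Fl (μ₂ - r) - Fl (μ₂ - 2 * r)) := by
          rw [hUB]; exact mul_le_mul_of_nonneg_left (min_le_right _ _) hrpos.le
      _ = (Fl (μ₂ - r) - Fl (μ₂ - 2 * r)) * r := by ring
  have h₁ : -deriv e m ≤ 1 - b := by
    have : 1 - b = Fl (m + 2 * r) := by rw [hb]; ring
    rw [this]; linarith
  have h₂ : 1 - a ≤ -deriv e μ₂ := by
    have : 1 - a = Fl (μ₂ - 2 * r) := by rw [ha]; ring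
    rw [this]; linarith
  obtain ⟨μ, hμ, hdens⟩ := exists_tendsto_gcDensity_of_regularWindow 1 U hm₂.le hlim hder h₁ h₂
    (δ := a) ⟨le_rfl, hab.le⟩
  exact ⟨μ, ⟨by rw [hm] at hμ; linarith [hμ.1], hμ.2⟩, hdens⟩

/-- **(Kpt) ∧ (M) ∧ (D) ⇒ typed crux**, recovered through (D_val) (same content as the split glue
`Theorems.wcbcsBcsConstruction_of_subs` attached on stmt-2010). [cite: KomaTasaki1994, §1] -/
theorem crux_of_Kpt_of_M_of_D (hKpt : Kpt) (hM : M) (hD : D) : Crux :=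
  crux_of_Kpt_of_M_of_Dval hKpt hM (Dval_of_D hD)

end Summit.HubbardSuperconductivity.HubbardSuperconductivity.Cruxes.WcbcsBcsConstruction.StrategyCensusS1
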